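import Summits.HodgeConjecture.HodgeConjecture.Theorems.TropicalWeilObstructionTropicalHodgeBoundCheckerEquations
import Summits.HodgeConjecture.HodgeConjecture.Theorems.TropicalWeilObstructionTropicalHodgeBoundCertRun1
import Summits.HodgeConjecture.HodgeConjecture.Theorems.TropicalWeilObstructionTropicalHodgeBoundCertRun2
import Summits.HodgeConjecture.HodgeConjecture.Theorems.TropicalWeilObstructionTropicalHodgeBoundCertRun3
import Summits.HodgeConjecture.HodgeConjecture.Theorems.TropicalWeilObstructionTropicalHodgeBoundCertRun4
import Summits.HodgeConjecture.HodgeConjecture.Theorems.TropicalWeilObstructionTropicalHodgeBoundCertRun5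
import Summits.HodgeConjecture.HodgeConjecture.Theorems.TropicalWeilObstructionTropicalHodgeBoundCertRun6
import Summits.HodgeConjecture.HodgeConjecture.Theorems.TropicalWeilObstructionTropicalHodgeBoundCertRun7

/-!
# Crux `TropicalHodgeBound` (stmt-HodgeConjecture-18480), stub 4 — part C5a: the certificate, assembled

Route `TropicalWeilObstruction` of `HodgeConjecture`, registered line `birth`
(`Cruxes/TropicalHodgeBound/Lines/birth.lean`), stub `stub_rationalHodgeCoordinates`; ingredient (C).

The `51` kernel-checked chunks (`…CertRun1–7`) cover all `4900` unknowns (`allFinals_cover`, by `decide`),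
the two large components being chained through their boundary facts. With the soundness of the checker
(`checkChunk_sound`) and of its equations (`stepEq_eval_eq_zero`) this gives the **rank statement**
(`rel_all`): for every alternating integer table `y` on pairs of words `Fin 4 → Fin 8` satisfying the
coefficient equations of `…Genericity`, every increasing-pair value is the fixed integer combination
`relRHS` of the three free values `y₀ = yvOf y 0`, `y₄`, `y₁₄` weighted by the values of
`(θ₄, Re w, Im w)` — i.e. the solution space is spanned by the three known classes
(Mikhalkin–Zharkov Thm. 5.4 / the route's "`4900 - 4897 = 3`"). No named fact, no sorry.

References: [Zharkov2020TropicalWeil] I. Zharkov, arXiv:2002.02347, §2; [MikhalkinZharkov2014Eigenwave]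
G. Mikhalkin, I. Zharkov, LN UMI 15 (2014), Thm. 5.4.
-/

set_option linter.dupNamespace false

namespace Summit.HodgeConjecture.HodgeConjecture.Theorems.TropicalHodgeBound

open Literature.AlgebraicGeometry.Tropical

namespace Chk

/-- The chunks consisting of whole components (no boundary facts). [folklore] -/
def simpleChunks : List (List ℕ) :=
  [ch6, ch7, ch8, ch9, ch10, ch11, ch12, ch13, ch14, ch15, ch16, ch17, ch18, ch19, ch20, ch21, ch22,
    ch23, ch24, ch25, ch26, ch27, ch28, ch29, ch30, ch31, ch32, ch33, ch34, ch35, ch36, ch37, ch38,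
    ch39, ch40, ch41, ch42, ch43, ch44, ch45, ch46, ch47, ch48, ch49, ch50]

/-- Every simple chunk passes the checker (collecting `…CertRun1–7`). [cite: Zharkov2020TropicalWeil, §2] -/
theorem simpleChunks_ok : ∀ c ∈ simpleChunks, checkChunk [] c [] (c.map stepTarget) = true := by
  unfold simpleChunks
  simp only [List.forall_mem_cons]
  refine ⟨chunk6_ok, chunk7_ok, chunk8_ok, chunk9_ok, chunk10_ok, chunk11_ok, chunk12_ok, chunk13_ok,
     chunk14_ok, chunk15_ok, chunk16_ok, chunk17_ok, chunk18_ok, chunk19_ok, chunk20_ok,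
     chunk21_ok, chunk22_ok, chunk23_ok, chunk24_ok, chunk25_ok, chunk26_ok, chunk27_ok,
     chunk28_ok, chunk29_ok, chunk30_ok, chunk31_ok, chunk32_ok, chunk33_ok, chunk34_ok,
     chunk35_ok, chunk36_ok, chunk37_ok, chunk38_ok, chunk39_ok, chunk40_ok, chunk41_ok,
     chunk42_ok, chunk43_ok, chunk44_ok, chunk45_ok, chunk46_ok, chunk47_ok, chunk48_ok,
     chunk49_ok, chunk50_ok, fun _ h => by simp at h⟩

/-- All unknowns certified by some chunk's final check. [folklore] -/
def allFinals : List ℕ :=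
  ((ch0 ++ ch1 ++ ch2).map stepTarget ++ [0, 4, 14]) ++ (ch3 ++ ch4 ++ ch5).map stepTarget ++
    simpleChunks.flatMap fun c => c.map stepTarget

/-! ### Coverage of `0, …, 4899` by the final lists (bucket sort, kernel-checked) -/

/-- Put `u` into bucket `i` (structural `modify`). [folklore] -/
def bump : List (List ℕ) → ℕ → ℕ → List (List ℕ)
  | [], _, _ => []
  | b :: B, 0, u => (u :: b) :: B
  | b :: B, i + 1, u => b :: bump B i u

/-- Distribute a list of unknown codes into `70` buckets by `u / 70`. [folklore] -/
def bucketize : List ℕ → List (List ℕ)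
  | [] => List.replicate 70 []
  | u :: l => bump (bucketize l) (u / 70) u

/-- Sort each bucket by insertion (`Chk.ins`) and concatenate. [folklore] -/
def flattenSorted (B : List (List ℕ)) : List ℕ := B.flatMap fun b => b.foldr ins []

set_option maxRecDepth 100000 in
set_option maxHeartbeats 400000000 in
/-- **Coverage**: the certified unknowns, bucket-sorted, are exactly `0, …, 4899`. [folklore] -/
theorem allFinals_cover : flattenSorted (bucketize allFinals) = List.range 4900 := by
  decide +kernel

/-- Insertion-sorting a bucket preserves membership. [folklore] -/
theorem mem_of_mem_foldr_ins (x : ℕ) : ∀ b : List ℕ, x ∈ b.foldr ins [] → x ∈ b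
  | [], h => by simp at h
  | a :: b, h => by
      rw [List.foldr_cons, (ins_perm a _).mem_iff, List.mem_cons] at h
      rcases h with rfl | h
      · exact List.mem_cons_self
      · exact List.mem_cons_of_mem _ (mem_of_mem_foldr_ins x b h)

/-- Membership through `bump`. [folklore] -/
theorem mem_of_mem_bump (x : ℕ) : ∀ (B : List (List ℕ)) (i u : ℕ) (b : List ℕ),
    b ∈ bump B i u → x ∈ b → x = u ∨ ∃ b' ∈ B, x ∈ b'
  | [], _, _, b, hb, _ => by simp [bump] at hb
  | b₀ :: B, 0, u, b, hb, hx => by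
      simp only [bump, List.mem_cons] at hb
      rcases hb with rfl | hb
      · rcases List.mem_cons.mp hx with rfl | hx
        · exact Or.inl rfl
        · exact Or.inr ⟨b₀, List.mem_cons_self, hx⟩
      · exact Or.inr ⟨b, List.mem_cons_of_mem _ hb, hx⟩
  | b₀ :: B, i + 1, u, b, hb, hx => by
      simp only [bump, List.mem_cons] at hb
      rcases hb with rfl | hb
      · exact Or.inr ⟨b, List.mem_cons_self, hx⟩
      · rcases mem_of_mem_bump x B i u b hb hx with h | ⟨b', hb', hx'⟩
        · exact Or.inl h
        · exact Or.inr ⟨b', List.mem_cons_of_mem _ hb', hx'⟩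

/-- Membership through `bucketize`. [folklore] -/
theorem mem_of_mem_bucketize (x : ℕ) : ∀ (l : List ℕ) (b : List ℕ), b ∈ bucketize l → x ∈ b → x ∈ l
  | [], b, hb, hx => by
      simp only [bucketize, List.mem_replicate] at hb
      rw [hb.2] at hx; simp at hx
  | u :: l, b, hb, hx => by
      rcases mem_of_mem_bump x (bucketize l) (u / 70) u b hb hx with rfl | ⟨b', hb', hx'⟩
      · exact List.mem_cons_self
      · exact List.mem_cons_of_mem _ (mem_of_mem_bucketize x l b' hb' hx')

/-- Every unknown code `< 4900` is certified. [folklore] -/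
theorem mem_allFinals (u : ℕ) (hu : u < 4900) : u ∈ allFinals := by
  have h : u ∈ flattenSorted (bucketize allFinals) := by
    rw [allFinals_cover]; exact List.mem_range.mpr hu
  unfold flattenSorted at h
  rw [List.mem_flatMap] at h
  obtain ⟨b, hb, hx⟩ := h
  exact mem_of_mem_bucketize u allFinals b hb (mem_of_mem_foldr_ins u b hx)

/-- **The rank statement** (certificate form): every alternating integer table satisfying the
coefficient equations is, on increasing word pairs, the fixed combination `relRHS` of its three free
values. [cite: MikhalkinZharkov2014Eigenwave, Thm. 5.4] [cite: Zharkov2020TropicalWeil, §2] -/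
theorem rel_all (y : (Fin 4 → Fin (2 * 4)) → (Fin 4 → Fin (2 * 4)) → ℤ)
    (hyI : ∀ (c d : Fin 4 → Fin (2 * 4)) (τ : Equiv.Perm (Fin 4)),
      y (c ∘ τ) d = ((Equiv.Perm.sign τ : ℤˣ) : ℤ) * y c d)
    (hyJ : ∀ (c d : Fin 4 → Fin (2 * 4)) (τ : Equiv.Perm (Fin 4)),
      y c (d ∘ τ) = ((Equiv.Perm.sign τ : ℤˣ) : ℤ) * y c d)
    (heq : ∀ (K' : Fin 5 → Fin (2 * 4)) (J' : Fin 3 → Fin (2 * 4)) (m₀ : Fin 5) (c₀ : Fin 4 → Fin (2 * 4)),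
      ∑ m : Fin 5, ∑ c : Fin 4 → Fin (2 * 4),
        (if (idxList (fun a => K' (m.succAbove a)) c).Perm (idxList (fun a => K' (m₀.succAbove a)) c₀) then
          (-1 : ℤ) ^ (m : ℕ) * signProd (fun a => K' (m.succAbove a)) c * y c (Fin.cons (K' m) J')
        else 0) = 0)
    (u : ℕ) (hu : u < 4900) : yvOf y u = relRHS (yvOf y) u := by
  have hst : ∀ n : ℕ, evalL (yvOf y) (stepEq n) = 0 := stepEq_eval_eq_zero y hyI hyJ heq
  have H := fun (fi : List (ℕ × Fact)) (st : List ℕ) (fo : List (ℕ × Fact)) (fl : List ℕ)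
      (hIn : ∀ p ∈ fi, p.2.1 * yvOf y p.1 = evalL (yvOf y) p.2.2)
      (h : checkChunk fi st fo fl = true) =>
    checkChunk_sound (yvOf y) fi st fo fl (fun n _ => hst n) hIn h
  have h0 : ∀ p ∈ ([] : List (ℕ × Fact)), p.2.1 * yvOf y p.1 = evalL (yvOf y) p.2.2 := by simp
  obtain ⟨hA1, -⟩ := H [] ch0 bfA1 [] h0 chunk0_ok
  obtain ⟨hA2, -⟩ := H bfA1 ch1 bfA2 [] hA1 chunk1_ok
  obtain ⟨-, f2⟩ := H bfA2 ch2 [] _ hA2 chunk2_ok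
  obtain ⟨hB1, -⟩ := H [] ch3 bfB1 [] h0 chunk3_ok
  obtain ⟨hB2, -⟩ := H bfB1 ch4 bfB2 [] hB1 chunk4_ok
  obtain ⟨-, f5⟩ := H bfB2 ch5 [] _ hB2 chunk5_ok
  have hm := mem_allFinals u hu
  unfold allFinals at hm
  simp only [List.mem_append, List.mem_flatMap] at hm
  rcases hm with (h | h) | ⟨c, hc, h⟩
  · exact f2 u (List.mem_append.mpr h)
  · exact f5 u h
  · exact (H [] c [] (c.map stepTarget) h0 (simpleChunks_ok c hc)).2 u h

end Chk

end Summit.HodgeConjecture.HodgeConjecture.Theorems.TropicalHodgeBound
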